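import Mathlib
import Literature.Analysis.FluidPDE.VectorCalculus
import Literature.Analysis.FluidPDE.LeiZhang2011Proofs

/-!
# Clause 13-R, STUB R at MODEL level: the nonlocal term of the model adjoint equation is a COMPACT operator on the continuous densities of the ball
# (census item (R-c′-E), global half, ingredient 1; crux `Clause13RNearStraightL`, stmt-NavierStokesRegularity-23612; line `rate_bordered_split`,
# STUB R `stub_rateRow13RFlat`)

Route `FilamentSkeletonRss`, Variant A1R.  The sourced MODEL adjoint equation of STUB R on the tangency ball `S = [a, b]`
(`…Clause13RAdjointEnergy`, `…Clause13REdgeMeasureModel`, `…Clause13RAdjointPunctured(Unique/Apriori)`) is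
  `cst • (m σ • (φ σ × d) − ∫_{τ∈S} k(τ−σ) • (φ τ × d) dτ) + ½ φ σ + α e × φ σ + w′ σ φ σ + w σ φ′ σ = h σ`:
a LOCAL first-order operator, degenerate at the waist (its waist-regular solution operator is constructed in `…Clause13RAdjointWaistExistence` /
`…WaistContinuity` / `…WaistBranch`, hand fsrs-25-g0), perturbed by the NONLOCAL term `N φ (σ) = ∫_{τ∈S} k(τ−σ) • (φ τ × d) dτ` with a CONTINUOUS kernel.
THIS FILE (def-free) proves that `N` is a COMPACT bounded linear operator on the Banach space `C(S; ℝ³)` (realised as `Icc a b →ᵇ ℝ³`):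
`exists_nonlocal_compactOperator` — there is `N : (Icc a b →ᵇ ℝ³) →L[ℝ] (Icc a b →ᵇ ℝ³)` with `(N φ)(σ) = ∫_{τ∈[a,b]} k(τ−σ) • (φ τ × d) dτ`
(the density extended constantly outside the ball, immaterial under `∫_{[a,b]}`) and `IsCompactOperator N`.  Proof: the image of the unit ball is bounded
by `(b − a)·sup|k|·‖d‖` and EQUICONTINUOUS with the modulus of uniform continuity of `k` on `[a − b, b − a]` (Heine–Cantor), so Arzelà–Ascoli
(`BoundedContinuousFunction.arzela_ascoli`, values in the proper space `ℝ³`) gives a compact closure.  With the uniqueness of bounded punctured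
densities (`…Clause13RAdjointPuncturedUnique` p832285) this is the compactness input of the Fredholm-alternative step of census item (R-c′-E)
(`IsCompactOperator.hasEigenvalue_or_mem_resolventSet`, Mathlib).  [folklore] (integral operators with continuous kernels are compact on `C(S)`).
Hand `leafhand-ns-filamentskeletonrs-25-g0` (LAND-ONLY); `--supports stmt-NavierStokesRegularity-23612` helper, def-free.  HONEST FRAMING: functional-analytic
bookkeeping for the MODEL adjoint equation attached to a HYPOTHETICAL filament skeleton on the NEGATIVE side of a MODEL blow-up route; STUB R is NOT proved
here and nothing in this file bears on Navier–Stokes regularity or blow-up.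
-/

noncomputable section

open MeasureTheory Filter Topology Set Metric BoundedContinuousFunction
open scoped RealInnerProductSpace InnerProductSpace BoundedContinuousFunction
open Literature.Analysis.FluidPDE

namespace Summit.NavierStokesRegularity.NavierStokesRegularity.Theorems.Clause13RAdjointNonlocalCompact
set_option linter.dupNamespace false

/-! ## §1 Pointwise tools -/

/-- The kernel integrand of the nonlocal term with a constantly-extended continuous density is continuous in `τ`. [folklore] -/
theorem continuous_integrand {a b : ℝ} (hab : a ≤ b) {k : ℝ → ℝ} (hk : Continuous k) (d : EuclideanSpace ℝ (Fin 3))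
    (φ : Icc a b →ᵇ EuclideanSpace ℝ (Fin 3)) (σ : ℝ) :
    Continuous fun τ => k (τ - σ) • cross (IccExtend hab φ τ) d := by
  have h1 : Continuous fun τ => IccExtend hab φ τ := φ.continuous.Icc_extend'
  have h2 : Continuous fun τ => cross (IccExtend hab φ τ) d := by
    have : Continuous fun τ => crossCLM (IccExtend hab φ τ) d := (crossCLM.continuous₂).comp (h1.prodMk continuous_const)
    simpa only [crossCLM_apply] using this
  exact (hk.comp (continuous_id.sub continuous_const)).smul h2

/-! ## §2 The nonlocal term as a compact operator on `C(S; ℝ³)` -/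

/-- **THE NONLOCAL TERM IS A COMPACT OPERATOR ON THE CONTINUOUS DENSITIES OF THE BALL.**  For `a ≤ b`, a continuous kernel `k` and a vector
`d` there is a bounded linear operator `N` on `Icc a b →ᵇ ℝ³` (= `C([a,b]; ℝ³)` with the sup norm) acting by
`(N φ)(σ) = ∫_{τ∈[a,b]} k(τ − σ) • (φ(τ) × d) dτ`, and `N` is a compact operator (Arzelà–Ascoli). [folklore] -/
theorem exists_nonlocal_compactOperator {a b : ℝ} (hab : a ≤ b) {k : ℝ → ℝ} (hk : Continuous k) (d : EuclideanSpace ℝ (Fin 3)) :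
    ∃ N : (Icc a b →ᵇ EuclideanSpace ℝ (Fin 3)) →L[ℝ] (Icc a b →ᵇ EuclideanSpace ℝ (Fin 3)),
      (∀ (φ : Icc a b →ᵇ EuclideanSpace ℝ (Fin 3)) (σ : Icc a b),
        N φ σ = ∫ τ in Icc a b, k (τ - σ) • cross (IccExtend hab φ τ) d) ∧
      IsCompactOperator N := by
  -- a bound for the kernel on the relevant range `[a - b, b - a]`
  obtain ⟨K, hK⟩ := (isCompact_Icc (a := a - b) (b := b - a)).exists_bound_of_continuousOn hk.continuousOn
  have hK0 : 0 ≤ K := (norm_nonneg _).trans (hK 0 ⟨by linarith, by linarith⟩)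
  have hKτ : ∀ τ ∈ Icc a b, ∀ σ ∈ Icc a b, |k (τ - σ)| ≤ K := fun τ hτ σ hσ => by
    have := hK (τ - σ) ⟨by linarith [hτ.1, hσ.2], by linarith [hτ.2, hσ.1]⟩
    rwa [Real.norm_eq_abs] at this
  have hvol : volume (Icc a b) < ⊤ := measure_Icc_lt_top
  have hvolr : volume.real (Icc a b) = b - a := Real.volume_real_Icc_of_le hab
  -- the raw operator and its pointwise estimates
  set Nf : (Icc a b →ᵇ EuclideanSpace ℝ (Fin 3)) → ℝ → EuclideanSpace ℝ (Fin 3) := fun φ σ =>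
    ∫ τ in Icc a b, k (τ - σ) • cross (IccExtend hab φ τ) d with hNf
  have hext_le : ∀ (φ : Icc a b →ᵇ EuclideanSpace ℝ (Fin 3)) τ, ‖IccExtend hab φ τ‖ ≤ ‖φ‖ := fun φ τ => by
    rw [IccExtend, Function.comp_apply]; exact φ.norm_coe_le_norm _
  have hpt : ∀ (φ : Icc a b →ᵇ EuclideanSpace ℝ (Fin 3)), ∀ σ ∈ Icc a b, ∀ τ ∈ Icc a b,
      ‖k (τ - σ) • cross (IccExtend hab φ τ) d‖ ≤ K * (‖φ‖ * ‖d‖) := fun φ σ hσ τ hτ => by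
    rw [norm_smul, Real.norm_eq_abs]
    exact mul_le_mul (hKτ τ hτ σ hσ) ((norm_cross_le_norm_mul_norm _ _).trans (mul_le_mul_of_nonneg_right (hext_le φ τ) (norm_nonneg _)))
      (norm_nonneg _) hK0
  have hNf_bound : ∀ (φ : Icc a b →ᵇ EuclideanSpace ℝ (Fin 3)), ∀ σ ∈ Icc a b, ‖Nf φ σ‖ ≤ K * (‖φ‖ * ‖d‖) * (b - a) := fun φ σ hσ => by
    have h := norm_setIntegral_le_of_norm_le_const hvol (hpt φ σ hσ)
    rwa [hvolr] at h
  -- equicontinuity modulus from the uniform continuity of `k` on `[a - b, b - a]`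
  have hmod : ∀ ε > 0, ∃ δ > 0, ∀ (φ : Icc a b →ᵇ EuclideanSpace ℝ (Fin 3)), ∀ σ ∈ Icc a b, ∀ σ' ∈ Icc a b, |σ - σ'| < δ →
      ‖Nf φ σ - Nf φ σ'‖ ≤ ε * (‖φ‖ * ‖d‖) * (b - a) := by
    intro ε hε
    have huc := (isCompact_Icc (a := a - b) (b := b - a)).uniformContinuousOn_of_continuous hk.continuousOn
    obtain ⟨δ, hδ, hδk⟩ := Metric.uniformContinuousOn_iff.1 huc ε hε
    refine ⟨δ, hδ, fun φ σ hσ σ' hσ' hd => ?_⟩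
    have hint : ∀ s ∈ Icc a b, IntegrableOn (fun τ => k (τ - s) • cross (IccExtend hab φ τ) d) (Icc a b) := fun s _ =>
      (continuous_integrand hab hk d φ s).integrableOn_Icc
    have hsub : Nf φ σ - Nf φ σ' = ∫ τ in Icc a b, (k (τ - σ) - k (τ - σ')) • cross (IccExtend hab φ τ) d := by
      simp only [hNf]
      rw [← integral_sub (hint σ hσ) (hint σ' hσ')]
      refine setIntegral_congr_fun measurableSet_Icc fun τ _ => ?_
      rw [sub_smul]
    rw [hsub]
    have hpt' : ∀ τ ∈ Icc a b, ‖(k (τ - σ) - k (τ - σ')) • cross (IccExtend hab φ τ) d‖ ≤ ε * (‖φ‖ * ‖d‖) := fun τ hτ => by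
      rw [norm_smul, Real.norm_eq_abs]
      have h1 : |k (τ - σ) - k (τ - σ')| ≤ ε := by
        have h := hδk (τ - σ) ⟨by linarith [hτ.1, hσ.2], by linarith [hτ.2, hσ.1]⟩ (τ - σ')
          ⟨by linarith [hτ.1, hσ'.2], by linarith [hτ.2, hσ'.1]⟩ (by rw [Real.dist_eq]; rw [show τ - σ - (τ - σ') = -(σ - σ') by ring, abs_neg]; exact hd)
        rw [Real.dist_eq] at h
        exact h.le
      exact mul_le_mul h1 ((norm_cross_le_norm_mul_norm _ _).trans (mul_le_mul_of_nonneg_right (hext_le φ τ) (norm_nonneg _)))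
        (norm_nonneg _) hε.le
    have h := norm_setIntegral_le_of_norm_le_const hvol hpt'
    rwa [hvolr] at h
  -- continuity of `σ ↦ Nf φ σ` on the ball
  have hNf_cont : ∀ (φ : Icc a b →ᵇ EuclideanSpace ℝ (Fin 3)), Continuous fun σ : Icc a b => Nf φ σ := fun φ => by
    refine Metric.continuous_iff.2 fun σ ε hε => ?_
    obtain ⟨δ, hδ, hδm⟩ := hmod (ε / ((‖φ‖ * ‖d‖) * (b - a) + 1)) (by positivity)
    refine ⟨δ, hδ, fun σ' hσ' => ?_⟩
    rw [dist_eq_norm]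
    have h := hδm φ σ' σ'.2 σ σ.2 (by
      have : dist σ' σ < δ := hσ'
      rwa [Subtype.dist_eq, Real.dist_eq] at this)
    refine lt_of_le_of_lt h ?_
    have hpos : 0 < (‖φ‖ * ‖d‖) * (b - a) + 1 := by positivity
    have hnn : 0 ≤ (‖φ‖ * ‖d‖) * (b - a) := by positivity
    rw [div_mul_eq_mul_div, div_mul_eq_mul_div, div_lt_iff₀ hpos]
    nlinarith
  -- the operator as a linear map into `Icc a b →ᵇ ℝ³`
  set Nb : (Icc a b →ᵇ EuclideanSpace ℝ (Fin 3)) → (Icc a b →ᵇ EuclideanSpace ℝ (Fin 3)) := fun φ =>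
    BoundedContinuousFunction.mkOfCompact ⟨fun σ : Icc a b => Nf φ σ, hNf_cont φ⟩ with hNb
  have hNb_apply : ∀ φ (σ : Icc a b), Nb φ σ = Nf φ σ := fun φ σ => rfl
  have hint : ∀ (φ : Icc a b →ᵇ EuclideanSpace ℝ (Fin 3)) (s : ℝ),
      IntegrableOn (fun τ => k (τ - s) • cross (IccExtend hab φ τ) d) (Icc a b) := fun φ s =>
    (continuous_integrand hab hk d φ s).integrableOn_Icc
  have hcross_add : ∀ x y : EuclideanSpace ℝ (Fin 3), cross (x + y) d = cross x d + cross y d := fun x y => by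
    rw [← crossCLM_apply, map_add, _root_.add_apply]; rfl
  have hcross_smul : ∀ (r : ℝ) (x : EuclideanSpace ℝ (Fin 3)), cross (r • x) d = r • cross x d := fun r x => by
    rw [← crossCLM_apply, map_smul, _root_.smul_apply]; rfl
  have hadd : ∀ φ ψ, Nb (φ + ψ) = Nb φ + Nb ψ := fun φ ψ => by
    ext σ : 1
    rw [BoundedContinuousFunction.add_apply, hNb_apply, hNb_apply, hNb_apply]
    simp only [hNf]
    rw [← integral_add (hint φ σ) (hint ψ σ)]
    refine setIntegral_congr_fun measurableSet_Icc fun τ _ => ?_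
    simp only [IccExtend, Function.comp_apply, BoundedContinuousFunction.coe_add, Pi.add_apply, hcross_add, smul_add]
  have hsmul : ∀ (r : ℝ) φ, Nb (r • φ) = r • Nb φ := fun r φ => by
    ext σ : 1
    rw [BoundedContinuousFunction.smul_apply, hNb_apply, hNb_apply]
    simp only [hNf]
    rw [← integral_smul]
    refine setIntegral_congr_fun measurableSet_Icc fun τ _ => ?_
    simp only [IccExtend, Function.comp_apply, BoundedContinuousFunction.coe_smul, hcross_smul, smul_comm (k _) r]
  set Nl : (Icc a b →ᵇ EuclideanSpace ℝ (Fin 3)) →ₗ[ℝ] (Icc a b →ᵇ EuclideanSpace ℝ (Fin 3)) :=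
    { toFun := Nb, map_add' := hadd, map_smul' := hsmul } with hNl
  have hNl_bound : ∀ φ, ‖Nl φ‖ ≤ (K * ‖d‖ * (b - a)) * ‖φ‖ := fun φ => by
    have h0 : 0 ≤ (K * ‖d‖ * (b - a)) * ‖φ‖ := by
      have : 0 ≤ b - a := sub_nonneg.2 hab
      positivity
    refine (BoundedContinuousFunction.norm_le h0).2 fun σ => ?_
    have h := hNf_bound φ σ σ.2
    calc ‖Nl φ σ‖ = ‖Nf φ σ‖ := rfl
      _ ≤ K * (‖φ‖ * ‖d‖) * (b - a) := h
      _ = (K * ‖d‖ * (b - a)) * ‖φ‖ := by ring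
  set N : (Icc a b →ᵇ EuclideanSpace ℝ (Fin 3)) →L[ℝ] (Icc a b →ᵇ EuclideanSpace ℝ (Fin 3)) :=
    Nl.mkContinuous (K * ‖d‖ * (b - a)) hNl_bound with hN
  have hN_apply : ∀ φ (σ : Icc a b), N φ σ = Nf φ σ := fun φ σ => rfl
  refine ⟨N, fun φ σ => hN_apply φ σ, ?_⟩
  -- compactness: Arzelà–Ascoli on the image of the closed unit ball
  set A : Set (Icc a b →ᵇ EuclideanSpace ℝ (Fin 3)) := (N : (Icc a b →ᵇ EuclideanSpace ℝ (Fin 3)) →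
    (Icc a b →ᵇ EuclideanSpace ℝ (Fin 3))) '' Metric.closedBall 0 1 with hA
  set R : ℝ := K * (1 * ‖d‖) * (b - a) with hR
  have in_s : ∀ (f : Icc a b →ᵇ EuclideanSpace ℝ (Fin 3)) (x : Icc a b), f ∈ A → f x ∈ Metric.closedBall (0 : EuclideanSpace ℝ (Fin 3)) R := by
    rintro f x ⟨φ, hφ, rfl⟩
    rw [mem_closedBall_zero_iff] at hφ
    rw [mem_closedBall_zero_iff]
    have h := hNf_bound φ x x.2
    have hba : 0 ≤ b - a := sub_nonneg.2 hab
    calc ‖N φ x‖ = ‖Nf φ x‖ := rfl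
      _ ≤ K * (‖φ‖ * ‖d‖) * (b - a) := h
      _ ≤ K * (1 * ‖d‖) * (b - a) := by gcongr
  have hequi : Equicontinuous ((↑) : A → Icc a b → EuclideanSpace ℝ (Fin 3)) := by
    intro x₀
    refine Metric.equicontinuousAt_iff.2 fun ε hε => ?_
    obtain ⟨δ, hδ, hδm⟩ := hmod (ε / (2 * (‖d‖ * (b - a) + 1))) (by
      have hba : 0 ≤ b - a := sub_nonneg.2 hab
      positivity)
    refine ⟨δ, hδ, fun x hx => ?_⟩
    rintro ⟨f, φ, hφ, rfl⟩
    rw [mem_closedBall_zero_iff] at hφ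
    have hxd : |(x₀ : ℝ) - x| < δ := by
      rw [Subtype.dist_eq, Real.dist_eq] at hx; rwa [abs_sub_comm]
    have h := hδm φ x₀ x₀.2 x x.2 hxd
    rw [dist_eq_norm]
    refine lt_of_le_of_lt h ?_
    have hba : 0 ≤ b - a := sub_nonneg.2 hab
    have hpos : 0 < 2 * (‖d‖ * (b - a) + 1) := by positivity
    have h1 : ε / (2 * (‖d‖ * (b - a) + 1)) * (‖φ‖ * ‖d‖) * (b - a) ≤ ε / (2 * (‖d‖ * (b - a) + 1)) * (1 * ‖d‖) * (b - a) := by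
      gcongr
    refine lt_of_le_of_lt h1 ?_
    rw [one_mul, div_mul_eq_mul_div, div_mul_eq_mul_div, div_lt_iff₀ hpos]
    nlinarith [mul_nonneg (norm_nonneg d) hba]
  have hcomp : IsCompact (closure A) :=
    BoundedContinuousFunction.arzela_ascoli (Metric.closedBall 0 R) (isCompact_closedBall 0 R) A in_s hequi
  exact (isCompactOperator_iff_isCompact_closure_image_closedBall
    (N : (Icc a b →ᵇ EuclideanSpace ℝ (Fin 3)) →ₗ[ℝ] (Icc a b →ᵇ EuclideanSpace ℝ (Fin 3))) one_pos).2 hcomp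

end Summit.NavierStokesRegularity.NavierStokesRegularity.Theorems.Clause13RAdjointNonlocalCompact

end
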